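import Literature.Geometry.DiscreteGeometry.SphericalCodeHemisphere
import Summits.AtomisticToContinuum.Crystallization.Theorems.TwoCentreKissingKernelRobustTangencyBoundLocal
import Summits.AtomisticToContinuum.Crystallization.Theorems.TwoCentreKissingKernelRobustTangencyBoundHull
import HarnessLib

/-!
# `RobustTangencyBound` — step (II) end to end: the normalised shell, balance, soft pairs as hull
# edges, and the defect budget `≤ 6` (helper file)

Route `TwoCentreKissingKernel`, item `stmt-AtomisticToContinuum-12082`.  Under the hypotheses of
`RobustTangencyBound` (`η ∈ [0, 10⁻³]`, twelve points `T`, norms in `[1 − η, 1 + η]`, pairwise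
`≥ 1 − η`, `≥ 48` ordered soft pairs), with `X = {y/‖y‖ : y ∈ T}` the normalised shell:

* `card_normalisedShell` — `X` has twelve points (normalisation is injective on the shell);
* `zero_mem_interior_convexHull_normalisedShell` — `0 ∈ interior (conv X)` (balance, from the
  cap-packing bound of `SphericalCodeHemisphere.lean` with `κ = 1/2 + 2η ≤ 0.502`);
* `softPairsOf` — the soft pairs of `T` pushed to `X` (two-element subsets), all hull edges of `X`
  (`softPairsOf_subset_hullEdges`, levels `κ₁ = 1/2 − 3η`, `κ₂ = 1/2 + 2η`), at least `24` of
  them (`twentyfour_le_card_softPairsOf`: the `≥ 48` ordered soft pairs map two-to-one onto them);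
* `defect_budget_normalisedShell` — hence (Legendre + Euler, `defect_budget_le_six`) the facets of
  `conv X` have polygonal excess `Σ_f (m_f − 3)` plus non-soft hull edges at most `6`.
-/

noncomputable section

namespace Summit.AtomisticToContinuum.Crystallization.Theorems

open Real RealInnerProductSpace Literature.Geometry.DiscreteGeometry Finset

variable {η : ℝ} {T : Finset (EuclideanSpace ℝ (Fin 3))}

/-- The normalised shell. Route-internal abbreviation. [folklore] -/
def normalisedShell (T : Finset (EuclideanSpace ℝ (Fin 3))) : Finset (EuclideanSpace ℝ (Fin 3)) :=
  T.image fun y => ‖y‖⁻¹ • y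

/-- Normalisation is injective on a shell (norms in `[1 − η, 1 + η]`, pairwise `≥ 1 − η`,
`η < 1/3`). -/
theorem normalise_injOn (hη : η < 1 / 3) (hnorm : ∀ y ∈ T, 1 - η ≤ ‖y‖ ∧ ‖y‖ ≤ 1 + η)
    (hsep : ∀ y ∈ T, ∀ y' ∈ T, y ≠ y' → 1 - η ≤ dist y y') :
    Set.InjOn (fun y : EuclideanSpace ℝ (Fin 3) => ‖y‖⁻¹ • y) ↑T := by
  intro y hy y' hy' h
  by_contra hne
  exact normalise_ne_of_le_dist hη (hnorm y hy).1 (hnorm y hy).2 (hnorm y' hy').1 (hnorm y' hy').2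
    (hsep y hy y' hy' hne) h

/-- The normalised shell of a twelve-point shell has twelve points. -/
theorem card_normalisedShell (hη : η < 1 / 3) (hT : T.card = 12)
    (hnorm : ∀ y ∈ T, 1 - η ≤ ‖y‖ ∧ ‖y‖ ≤ 1 + η)
    (hsep : ∀ y ∈ T, ∀ y' ∈ T, y ≠ y' → 1 - η ≤ dist y y') :
    (normalisedShell T).card = 12 := by
  rw [normalisedShell, Finset.card_image_of_injOn (normalise_injOn hη hnorm hsep), hT]

/-- Points of the normalised shell are unit vectors. -/
theorem norm_eq_one_of_mem_normalisedShell (hη : η < 1)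
    (hnorm : ∀ y ∈ T, 1 - η ≤ ‖y‖ ∧ ‖y‖ ≤ 1 + η) :
    ∀ u ∈ normalisedShell T, ‖u‖ = 1 := by
  intro u hu
  obtain ⟨y, hy, rfl⟩ := Finset.mem_image.1 hu
  exact norm_normalise (ne_zero_of_norm_mem hη (hnorm y hy).1)

/-- Distinct points of the normalised shell have inner product `≤ 1/2 + 2η`. -/
theorem inner_le_of_mem_normalisedShell (hη0 : 0 ≤ η) (hη : η ≤ 1 / 10)
    (hnorm : ∀ y ∈ T, 1 - η ≤ ‖y‖ ∧ ‖y‖ ≤ 1 + η)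
    (hsep : ∀ y ∈ T, ∀ y' ∈ T, y ≠ y' → 1 - η ≤ dist y y') :
    ∀ u ∈ normalisedShell T, ∀ u' ∈ normalisedShell T, u ≠ u' → ⟪u, u'⟫ ≤ 1 / 2 + 2 * η := by
  intro u hu u' hu' hne
  obtain ⟨y, hy, rfl⟩ := Finset.mem_image.1 hu
  obtain ⟨y', hy', rfl⟩ := Finset.mem_image.1 hu'
  have hyy : y ≠ y' := fun h => hne (by rw [h])
  exact inner_normalise_le_of_le_dist hη0 hη (hnorm y hy).1 (hnorm y hy).2 (hnorm y' hy').1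
    (hnorm y' hy').2 (hsep y hy y' hy' hyy)

/-- **Balance of the normalised shell**: `0 ∈ interior (conv X)` (`η ∈ [0, 10⁻³]`, twelve points).
-/
theorem zero_mem_interior_convexHull_normalisedShell (hη0 : 0 ≤ η) (hη : η ≤ 1 / 1000)
    (hT : T.card = 12) (hnorm : ∀ y ∈ T, 1 - η ≤ ‖y‖ ∧ ‖y‖ ≤ 1 + η)
    (hsep : ∀ y ∈ T, ∀ y' ∈ T, y ≠ y' → 1 - η ≤ dist y y') :
    (0 : EuclideanSpace ℝ (Fin 3)) ∈
      interior (convexHull ℝ (normalisedShell T : Set (EuclideanSpace ℝ (Fin 3)))) :=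
  zero_mem_interior_convexHull_of_twelve_soft
    (norm_eq_one_of_mem_normalisedShell (by linarith) hnorm)
    (card_normalisedShell (by linarith) hT hnorm hsep) (κ := 1 / 2 + 2 * η) (by linarith)
    (inner_le_of_mem_normalisedShell hη0 (by linarith) hnorm hsep)

/-! ### Soft pairs -/

/-- The ordered soft pairs of `T` (distinct points at distance `≤ 1 + η`), as a `Finset`. -/
def orderedSoftPairs (η : ℝ) (T : Finset (EuclideanSpace ℝ (Fin 3))) :
    Finset (EuclideanSpace ℝ (Fin 3) × EuclideanSpace ℝ (Fin 3)) :=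
  (T ×ˢ T).filter fun p => p.1 ≠ p.2 ∧ dist p.1 p.2 ≤ 1 + η

/-- The `Nat.card` count of the item equals the number of ordered soft pairs. -/
theorem natCard_eq_card_orderedSoftPairs (η : ℝ) (T : Finset (EuclideanSpace ℝ (Fin 3))) :
    Nat.card {q : ↥T × ↥T // q.1 ≠ q.2 ∧ dist (q.1 : EuclideanSpace ℝ (Fin 3)) q.2 ≤ 1 + η} =
      (orderedSoftPairs η T).card := by
  classical
  rw [← Nat.card_eq_finsetCard]
  refine Nat.card_congr
    { toFun := fun q => ⟨((q.1.1 : EuclideanSpace ℝ (Fin 3)), (q.1.2 : EuclideanSpace ℝ (Fin 3))),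
        mem_filter.2 ⟨mem_product.2 ⟨q.1.1.2, q.1.2.2⟩, fun h => q.2.1 (Subtype.ext h), q.2.2⟩⟩
      invFun := fun p =>
        ⟨(⟨p.1.1, (mem_product.1 (mem_filter.1 p.2).1).1⟩,
          ⟨p.1.2, (mem_product.1 (mem_filter.1 p.2).1).2⟩),
          fun h => (mem_filter.1 p.2).2.1 (congrArg Subtype.val h), (mem_filter.1 p.2).2.2⟩
      left_inv := fun q => rfl
      right_inv := fun p => rfl }

/-- **The soft pairs of `T` pushed to the normalised shell**: the two-element subsets
`{y/‖y‖, y'/‖y'‖}` for ordered soft pairs `(y, y')` of `T`. Route-internal. [folklore] -/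
def softPairsOf (η : ℝ) (T : Finset (EuclideanSpace ℝ (Fin 3))) :
    Finset (Finset (EuclideanSpace ℝ (Fin 3))) :=
  (orderedSoftPairs η T).image fun p => {‖p.1‖⁻¹ • p.1, ‖p.2‖⁻¹ • p.2}

/-- Every soft pair of the normalised shell is a hull edge (`η ∈ [0, 1/50]`). -/
theorem softPairsOf_subset_hullEdges (hη0 : 0 ≤ η) (hη : η ≤ 1 / 50)
    (hnorm : ∀ y ∈ T, 1 - η ≤ ‖y‖ ∧ ‖y‖ ≤ 1 + η)
    (hsep : ∀ y ∈ T, ∀ y' ∈ T, y ≠ y' → 1 - η ≤ dist y y') :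
    softPairsOf η T ⊆ hullEdges (normalisedShell T) := by
  classical
  intro e he
  obtain ⟨p, hp, rfl⟩ := Finset.mem_image.1 he
  obtain ⟨hpT, hne, hd⟩ := Finset.mem_filter.1 hp
  obtain ⟨h1, h2⟩ := Finset.mem_product.1 hpT
  have hu : ‖p.1‖⁻¹ • p.1 ∈ normalisedShell T := Finset.mem_image_of_mem _ h1
  have hv : ‖p.2‖⁻¹ • p.2 ∈ normalisedShell T := Finset.mem_image_of_mem _ h2
  have hne' : ‖p.1‖⁻¹ • p.1 ≠ ‖p.2‖⁻¹ • p.2 :=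
    normalise_ne_of_le_dist (by linarith) (hnorm _ h1).1 (hnorm _ h1).2 (hnorm _ h2).1
      (hnorm _ h2).2 (hsep _ h1 _ h2 hne)
  have hsoft : 1 / 2 - 3 * η ≤ ⟪‖p.1‖⁻¹ • p.1, ‖p.2‖⁻¹ • p.2⟫ :=
    le_inner_normalise_of_dist_le hη0 (by linarith) (hnorm _ h1).1 (hnorm _ h1).2 (hnorm _ h2).1
      (hnorm _ h2).2 hd
  exact pair_mem_hullEdges_of_soft_contact (norm_eq_one_of_mem_normalisedShell (by linarith) hnorm)
    (κ₁ := 1 / 2 - 3 * η) (κ₂ := 1 / 2 + 2 * η) (by linarith) (by linarith)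
    (inner_le_of_mem_normalisedShell hη0 (by linarith) hnorm hsep) hu hv hne' hsoft

/-- The push-forward of ordered soft pairs to soft pairs is at most two-to-one. -/
theorem card_orderedSoftPairs_le (hη : η < 1 / 3)
    (hnorm : ∀ y ∈ T, 1 - η ≤ ‖y‖ ∧ ‖y‖ ≤ 1 + η)
    (hsep : ∀ y ∈ T, ∀ y' ∈ T, y ≠ y' → 1 - η ≤ dist y y') :
    (orderedSoftPairs η T).card ≤ 2 * (softPairsOf η T).card := by
  classical
  unfold softPairsOf
  refine Finset.card_le_mul_card_image _ 2 fun b hb => ?_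
  obtain ⟨p, hp, rfl⟩ := Finset.mem_image.1 hb
  have hinj := normalise_injOn hη hnorm hsep
  -- the fibre is contained in `{p, p.swap}`
  have hsub : ((orderedSoftPairs η T).filter fun q =>
      ({‖q.1‖⁻¹ • q.1, ‖q.2‖⁻¹ • q.2} : Finset (EuclideanSpace ℝ (Fin 3))) =
        {‖p.1‖⁻¹ • p.1, ‖p.2‖⁻¹ • p.2}) ⊆ {p, p.swap} := by
    intro q hq
    obtain ⟨hq, heq⟩ := Finset.mem_filter.1 hq
    obtain ⟨hqT, -, -⟩ := Finset.mem_filter.1 hq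
    obtain ⟨hq1, hq2⟩ := Finset.mem_product.1 hqT
    obtain ⟨hpT, -, -⟩ := Finset.mem_filter.1 hp
    obtain ⟨hp1, hp2⟩ := Finset.mem_product.1 hpT
    have hm1 : ‖q.1‖⁻¹ • q.1 ∈ ({‖p.1‖⁻¹ • p.1, ‖p.2‖⁻¹ • p.2} : Finset _) := by
      rw [← heq]; exact Finset.mem_insert_self _ _
    have hm2 : ‖q.2‖⁻¹ • q.2 ∈ ({‖p.1‖⁻¹ • p.1, ‖p.2‖⁻¹ • p.2} : Finset _) := by
      rw [← heq]; exact Finset.mem_insert_of_mem (Finset.mem_singleton_self _)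
    have hm1' : ‖p.1‖⁻¹ • p.1 ∈ ({‖q.1‖⁻¹ • q.1, ‖q.2‖⁻¹ • q.2} : Finset _) := by
      rw [heq]; exact Finset.mem_insert_self _ _
    have hm2' : ‖p.2‖⁻¹ • p.2 ∈ ({‖q.1‖⁻¹ • q.1, ‖q.2‖⁻¹ • q.2} : Finset _) := by
      rw [heq]; exact Finset.mem_insert_of_mem (Finset.mem_singleton_self _)
    rw [Finset.mem_insert, Finset.mem_singleton] at hm1 hm2 hm1' hm2'
    rw [Finset.mem_insert, Finset.mem_singleton]
    rcases hm1 with h11 | h12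
    · have e1 : q.1 = p.1 := hinj hq1 hp1 h11
      rcases hm2' with h21 | h22
      · -- `p.2 ↦ q.1 = p.1`: then `p.1, p.2` have the same normalisation, so are equal
        have : p.2 = q.1 := hinj hp2 hq1 h21
        rcases hm2 with h2a | h2b
        · have e2 : q.2 = p.1 := hinj hq2 hp1 h2a
          obtain ⟨-, hqne, -⟩ := Finset.mem_filter.1 hq
          exact absurd (e1.trans e2.symm) hqne
        · left; exact Prod.ext e1 (hinj hq2 hp2 h2b)
      · left; exact Prod.ext e1 ((hinj hp2 hq2 h22).symm)
    · have e1 : q.1 = p.2 := hinj hq1 hp2 h12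
      rcases hm1' with h1a | h1b
      · have : p.1 = q.1 := hinj hp1 hq1 h1a
        rcases hm2 with h2a | h2b
        · right; exact Prod.ext e1 (hinj hq2 hp1 h2a)
        · have e2 : q.2 = p.2 := hinj hq2 hp2 h2b
          obtain ⟨-, hqne, -⟩ := Finset.mem_filter.1 hq
          exact absurd (e1.trans e2.symm) hqne
      · right; exact Prod.ext e1 ((hinj hp1 hq2 h1b).symm)
  calc ((orderedSoftPairs η T).filter fun q =>
        ({‖q.1‖⁻¹ • q.1, ‖q.2‖⁻¹ • q.2} : Finset (EuclideanSpace ℝ (Fin 3))) =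
          {‖p.1‖⁻¹ • p.1, ‖p.2‖⁻¹ • p.2}).card
      ≤ ({p, p.swap} : Finset _).card := Finset.card_le_card hsub
    _ ≤ 2 := Finset.card_le_two

/-- **At least `24` soft pairs** when the item counts `≥ 48` ordered ones. -/
theorem twentyfour_le_card_softPairsOf (hη : η < 1 / 3)
    (hnorm : ∀ y ∈ T, 1 - η ≤ ‖y‖ ∧ ‖y‖ ≤ 1 + η)
    (hsep : ∀ y ∈ T, ∀ y' ∈ T, y ≠ y' → 1 - η ≤ dist y y')
    (h48 : 48 ≤ Nat.card
      {q : ↥T × ↥T // q.1 ≠ q.2 ∧ dist (q.1 : EuclideanSpace ℝ (Fin 3)) q.2 ≤ 1 + η}) :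
    24 ≤ (softPairsOf η T).card := by
  rw [natCard_eq_card_orderedSoftPairs] at h48
  have := card_orderedSoftPairs_le hη hnorm hsep
  omega

/-- **Step (II) of the programme, end to end.** Under the hypotheses of `RobustTangencyBound`,
the normalised shell `X` has twelve points, `0 ∈ interior (conv X)`, its `≥ 24` soft pairs are
hull edges, and the facets of `conv X` have polygonal excess plus non-soft hull edges `≤ 6`. -/
theorem defect_budget_normalisedShell (hη0 : 0 ≤ η) (hη : η ≤ 1 / 1000) (hT : T.card = 12)
    (hnorm : ∀ y ∈ T, 1 - η ≤ ‖y‖ ∧ ‖y‖ ≤ 1 + η)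
    (hsep : ∀ y ∈ T, ∀ y' ∈ T, y ≠ y' → 1 - η ≤ dist y y')
    (h48 : 48 ≤ Nat.card
      {q : ↥T × ↥T // q.1 ≠ q.2 ∧ dist (q.1 : EuclideanSpace ℝ (Fin 3)) q.2 ≤ 1 + η}) :
    (∑ c ∈ facetNormals (normalisedShell T), (tightSet (normalisedShell T) c).card -
        3 * (facetNormals (normalisedShell T)).card) +
      ((hullEdges (normalisedShell T)).card - (softPairsOf η T).card) ≤ 6 :=
  defect_budget_le_six (norm_eq_one_of_mem_normalisedShell (by linarith) hnorm)
    (zero_mem_interior_convexHull_normalisedShell hη0 hη hT hnorm hsep)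
    (card_normalisedShell (by linarith) hT hnorm hsep)
    (softPairsOf_subset_hullEdges hη0 (by linarith) hnorm hsep)
    (twentyfour_le_card_softPairsOf (by linarith) hnorm hsep h48)

end Summit.AtomisticToContinuum.Crystallization.Theorems

end
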